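import Summits.QuantumFields.YangMills.Theses.FradkinShenkerFlow
import Summits.QuantumFields.YangMills.Theorems.FradkinShenkerFlowSusceptibilityToPoincareOrbitSliceSplit

/-!
# Line `orbit-slice-reduction` — lead's RESHAPED skeleton for crux stmt-QuantumFields-9441
(`Summit.QuantumFields.YangMills.Theses.FradkinShenkerFlow.SusceptibilityToPoincare`, FS(β) ⇒ UP(β))

Lead `prover-line-stmt-QuantumFields-9441-r-0` (re-seated, full protocol), 2026-08-16, continuing the skeleton of
`Cruxes/SusceptibilityToPoincare/Lines/orbit-slice-reduction.lean` (planner sha 521baf1b3135, previous lead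
`prover-line-stmt-QuantumFields-9441-lean-0`).

Crux (route FradkinShenkerFlow, rank 2): for every compact simple Lie group `G`, faithful unitary lattice representation
`r`, `β ≥ 0`: finite gauge-invariant susceptibility of the torus Wilson measures uniformly in the side `2S+1` (FS) implies a
UNIFORM single-link HEAT-BATH Poincaré inequality `Var_μ F ≤ C Σ_ℓ ∫∫ (F U − F (U[ℓ ↦ g]))² dν_ℓ^U(g) dμ(U)` for ALL
bounded measurable `F` (UP).

Line: ORBIT–SLICE SPLITTING. `π = Haar^{⊗ sites}`, `F̄ U = ∫ F(U^g) dπ(g)`.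
  (1) `Var_μ F ≤ Var_μ F̄ + E_μ Var_π(g ↦ F(U^g))`, `F̄` bounded measurable gauge-INVARIANT — `stub_orbitSliceSplit`,
      LANDED (p72371, `Theorems/FradkinShenkerFlowSusceptibilityToPoincareOrbitSliceSplit.lean`), imported here.
  (2) the orbit term is bounded by the heat-bath Dirichlet form uniformly in the volume ("no gauge-variant slow mode"),
      `E_μ Var_π(F(U^·)) ≤ C(β,G,r) ℰ_hb(F)` — theorem `gaugeOrbitGap_of` below, PROVED from three registered stubs
      (RESHAPE of the planner's single L-sized `stub_gaugeOrbitGap`, this seat):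
      (2a) `stub_orbitEfronStein` — Efron–Stein on the gauge group `G^{sites}` + invariance of `μ`:
           `E_μ Var_π(F(U^·)) ≤ ½ Σ_x ∫∫ (F U − F(U^{k at x}))² dHaar(k) dμ(U)`;
      (2b) `stub_siteRotation_le` — one site rotation costs at most the Haar-resampling of its ≤ 8 incident links:
           `∫∫ (F U − F(U^{k at x}))² dk dμ ≤ C Σ_{ℓ ∋ x} ∫∫ (F U − F(U[ℓ↦h]))² dHaar(h) dμ(U)` (telescoping over the
           incident links; the laws of partially rotated configurations have density `e^{O(N|β|)}` w.r.t. `μ`,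
           `wilsonMeasure_eq_tilted_pi` + two-sided invariance of Haar);
      (2c) `stub_haarResample_le_heatBath` — Haar resampling of a link costs at most `e^{12N|β|}` times heat-bath
           resampling (the tilt `−β S_W(U[ℓ↦·])` oscillates by `≤ 12 N |β|`), and each link is incident to ≤ 2 sites.
  (3) orbit averaging contracts the heat-bath Dirichlet form, `ℰ_hb(F̄) ≤ ℰ_hb(F)` — `stub_dirichlet_orbitAverage_le`
      (Jensen in `k`; gauge-COVARIANCE of the one-link heat-bath law; invariance of `μ`).
  (1)–(3) give the TRANSFER `UP_inv ⇒ UP` for every compact `G` and real `β` (`transfer_of`, sorry-free from the stub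
  statements), so the crux is EQUIVALENT to `C⁺ := FS ⇒ UP_inv` (`crux_iff_inv_of`). The infrared content `C⁺` is cut along π₁(G):
  (4a) `stub_fsPoincareInv_simplyConnected` — OPEN, XL, the crux's content for the summit's groups; held by the lead;
  (4b) `stub_fsPoincareInv_nonSimplyConnected` — SCOPE SENTINEL (SO(3), PSU(N) …), suspected false; not staffed.

Disproof.lean (cdisprove v1, `Cruxes/SusceptibilityToPoincare/Disproof.lean`, read 2026-08-16T01:15Z) — honoured:
  * §1 bottleneck lemma `flux_lower_bound_of_UP` / `not_UP_of_bottleneck` (proved): any UP-proof must exclude events of mass in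
    `[δ,1−δ]` with vanishing heat-bath flux — consistent with (2): gauge-variant events have flux ≥ e^{−O(β)}·mass deficit.
  * §2 `susceptibilityToPoincare_false_of_twistSectorInputs : TwistSectorInputs → ¬ crux` (negative MODULO H; H not
    constructible: needs FS of SO(3)₄ at weak coupling + twist-sector non-degeneracy). The crux hypothesis FS is used in this
    skeleton ONLY in (4a)/(4b); stubs (1)–(3) are unconditional theorems about every compact `G`, real `β`, every `S`.
  * §3 `stub4b_false_of_twistSectorInputs`: kills (4b) modulo the same H — (4b) stays an unstaffed sentinel; a landed
    unconditional `¬ stub 4b` re-scopes the crux (planner) and leaves (1)–(3), (4a) verbatim.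
  * no `Theorems/SusceptibilityToPoincare/Negative/*` landed (nothing to import).
Sorries: exactly the six `stub_*` below other than `stub_orbitSliceSplit`. Stub signatures are spelled over tree declarations
with type ascriptions `(wilsonMeasure r.ρ β : Measure (GaugeConfig 4 (2 * S + 1) G))` (definitionally the crux's
`wilsonMeasure (d := 4) (L := 2 * S + 1) r.ρ β`; the ascription keeps `:=` out of registered signatures).
-/

namespace Summit.QuantumFields.YangMills.Cruxes.SusceptibilityToPoincare.OrbitSliceReduction

open MeasureTheory ProbabilityTheory
open Literature.MathematicalPhysics.QuantumFieldTheory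

noncomputable section

/-! ### §0 Vocabulary (transparent abbreviations of VERBATIM sub-formulas of the crux; used only in the
sorry-free composition — the registered stubs below are spelled out over tree declarations) -/

section Vocabulary

variable {G : Type} [Group G] [TopologicalSpace G] [IsTopologicalGroup G] [CompactSpace G]
  [MeasurableSpace G] [BorelSpace G]

/-- FS(r, β): finite gauge-invariant susceptibility uniformly in the volume — verbatim the crux hypothesis. -/
def FS (r : LatticeRep G) (β : ℝ) : Prop :=
  ∀ A B : YMSpecies G, ∃ χ : ℝ, ∀ S : ℕ, ∑ x ∈ Literature.Probability.LatticeModels.box 4 S,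
    |covariance (fun U => A.F (Literature.MathematicalPhysics.QuantumLattice.torusLift (2 * S + 1) U))
      (fun U => B.F (Literature.MathematicalPhysics.QuantumLattice.configShift (-x)
          (Literature.MathematicalPhysics.QuantumLattice.torusLift (2 * S + 1) U)))
      (wilsonMeasure (d := 4) (L := 2 * S + 1) r.ρ β)| ≤ χ

/-- UP(r, β): the uniform single-link heat-bath Poincaré inequality for ALL bounded measurable `F` — verbatim the
crux conclusion. -/
def UP (r : LatticeRep G) (β : ℝ) : Prop :=
  ∃ C : ℝ, ∀ S : ℕ, ∀ F : GaugeConfig 4 (2 * S + 1) G → ℝ, Measurable F → (∃ M : ℝ, ∀ U, |F U| ≤ M) →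
    variance F (wilsonMeasure (d := 4) (L := 2 * S + 1) r.ρ β) ≤
      C * ∑ ℓ : Edge 4 (2 * S + 1), ∫ U, ∫ g, (F U - F (Function.update U ℓ g)) ^ 2
        ∂((haarProbability G).tilted (fun g' => -β * wilsonAction r.ρ (Function.update U ℓ g')))
        ∂(wilsonMeasure (d := 4) (L := 2 * S + 1) r.ρ β)

/-- UP_inv(r, β): the same Poincaré inequality demanded only for GAUGE-INVARIANT bounded measurable `F`. -/
def UPInv (r : LatticeRep G) (β : ℝ) : Prop :=
  ∃ C : ℝ, ∀ S : ℕ, ∀ F : GaugeConfig 4 (2 * S + 1) G → ℝ, Measurable F → (∃ M : ℝ, ∀ U, |F U| ≤ M) →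
    IsGaugeInvariant F →
    variance F (wilsonMeasure (d := 4) (L := 2 * S + 1) r.ρ β) ≤
      C * ∑ ℓ : Edge 4 (2 * S + 1), ∫ U, ∫ g, (F U - F (Function.update U ℓ g)) ^ 2
        ∂((haarProbability G).tilted (fun g' => -β * wilsonAction r.ρ (Function.update U ℓ g')))
        ∂(wilsonMeasure (d := 4) (L := 2 * S + 1) r.ρ β)

/-- The trivial direction of the transfer: UP ⇒ UP_inv. -/
theorem upInv_of_up (r : LatticeRep G) (β : ℝ) (h : UP r β) : UPInv r β := by
  obtain ⟨C, hC⟩ := h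
  exact ⟨C, fun S F hF hM _ => hC S F hF hM⟩

end Vocabulary

/-- The crux, re-read through `FS`/`UP` (definitional). -/
theorem crux_iff :
    Summit.QuantumFields.YangMills.Theses.FradkinShenkerFlow.SusceptibilityToPoincare ↔
      ∀ (G : Type) [Group G] [TopologicalSpace G] [IsTopologicalGroup G] [CompactSpace G]
        [MeasurableSpace G] [BorelSpace G], IsCompactSimpleLieGroup G →
        ∀ (r : LatticeRep G) (β : ℝ), 0 ≤ β → FS r β → UP r β :=
  Iff.rfl

/-! ### §1 Statements of the seven stubs as named propositions (for the sorry-free composition) -/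

/-- Statement of stub (1) `stub_orbitSliceSplit` (LANDED). -/
def OrbitSliceSplit : Prop :=
  ∀ (G : Type) [Group G] [TopologicalSpace G] [IsTopologicalGroup G] [CompactSpace G]
    [MeasurableSpace G] [BorelSpace G] (r : LatticeRep G) (β : ℝ) (S : ℕ)
    (F : GaugeConfig 4 (2 * S + 1) G → ℝ), Measurable F → ∀ M : ℝ, (∀ U, |F U| ≤ M) →
    Measurable (fun U : GaugeConfig 4 (2 * S + 1) G =>
        ∫ g, F (gaugeTransform g U) ∂(Measure.pi fun _ : Site 4 (2 * S + 1) => haarProbability G)) ∧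
    (∀ U : GaugeConfig 4 (2 * S + 1) G,
        |∫ g, F (gaugeTransform g U) ∂(Measure.pi fun _ : Site 4 (2 * S + 1) => haarProbability G)| ≤ M) ∧
    IsGaugeInvariant (fun U : GaugeConfig 4 (2 * S + 1) G =>
        ∫ g, F (gaugeTransform g U) ∂(Measure.pi fun _ : Site 4 (2 * S + 1) => haarProbability G)) ∧
    variance F (wilsonMeasure r.ρ β : Measure (GaugeConfig 4 (2 * S + 1) G)) ≤
      variance (fun U : GaugeConfig 4 (2 * S + 1) G =>
          ∫ g, F (gaugeTransform g U) ∂(Measure.pi fun _ : Site 4 (2 * S + 1) => haarProbability G))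
        (wilsonMeasure r.ρ β : Measure (GaugeConfig 4 (2 * S + 1) G)) +
      ∫ U, variance (fun g : Site 4 (2 * S + 1) → G => F (gaugeTransform g U))
          (Measure.pi fun _ : Site 4 (2 * S + 1) => haarProbability G)
        ∂(wilsonMeasure r.ρ β : Measure (GaugeConfig 4 (2 * S + 1) G))

/-- Statement of stub (2a) `stub_orbitEfronStein`. -/
def OrbitEfronStein : Prop :=
  ∀ (G : Type) [Group G] [TopologicalSpace G] [IsTopologicalGroup G] [CompactSpace G]
    [MeasurableSpace G] [BorelSpace G] (r : LatticeRep G) (β : ℝ) (S : ℕ)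
    (F : GaugeConfig 4 (2 * S + 1) G → ℝ), Measurable F → (∃ M : ℝ, ∀ U, |F U| ≤ M) →
    ∫ U, variance (fun g : Site 4 (2 * S + 1) → G => F (gaugeTransform g U))
        (Measure.pi fun _ : Site 4 (2 * S + 1) => haarProbability G)
      ∂(wilsonMeasure r.ρ β : Measure (GaugeConfig 4 (2 * S + 1) G)) ≤
    (1 / 2 : ℝ) * ∑ x : Site 4 (2 * S + 1), ∫ U, ∫ k,
        (F U - F (gaugeTransform (Function.update (1 : Site 4 (2 * S + 1) → G) x k) U)) ^ 2
      ∂(haarProbability G) ∂(wilsonMeasure r.ρ β : Measure (GaugeConfig 4 (2 * S + 1) G))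

/-- Statement of stub (2b) `stub_siteRotation_le`. -/
def SiteRotationLe : Prop :=
  ∀ (G : Type) [Group G] [TopologicalSpace G] [IsTopologicalGroup G] [CompactSpace G]
    [MeasurableSpace G] [BorelSpace G] (r : LatticeRep G) (β : ℝ), ∃ C : ℝ, ∀ (S : ℕ)
    (F : GaugeConfig 4 (2 * S + 1) G → ℝ), Measurable F → (∃ M : ℝ, ∀ U, |F U| ≤ M) →
    ∀ x : Site 4 (2 * S + 1),
    ∫ U, ∫ k, (F U - F (gaugeTransform (Function.update (1 : Site 4 (2 * S + 1) → G) x k) U)) ^ 2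
      ∂(haarProbability G) ∂(wilsonMeasure r.ρ β : Measure (GaugeConfig 4 (2 * S + 1) G)) ≤
    C * ∑ ℓ : Edge 4 (2 * S + 1), if (ℓ.1 = x ∨ ℓ.1.shift ℓ.2 = x) then
        ∫ U, ∫ h, (F U - F (Function.update U ℓ h)) ^ 2
          ∂(haarProbability G) ∂(wilsonMeasure r.ρ β : Measure (GaugeConfig 4 (2 * S + 1) G)) else 0

/-- Statement of stub (2c) `stub_haarResample_le_heatBath`. -/
def HaarResampleLeHeatBath : Prop :=
  ∀ (G : Type) [Group G] [TopologicalSpace G] [IsTopologicalGroup G] [CompactSpace G]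
    [MeasurableSpace G] [BorelSpace G] (r : LatticeRep G) (β : ℝ), ∃ C : ℝ, ∀ (S : ℕ)
    (F : GaugeConfig 4 (2 * S + 1) G → ℝ), Measurable F → (∃ M : ℝ, ∀ U, |F U| ≤ M) →
    ∑ x : Site 4 (2 * S + 1), ∑ ℓ : Edge 4 (2 * S + 1), (if (ℓ.1 = x ∨ ℓ.1.shift ℓ.2 = x) then
        ∫ U, ∫ h, (F U - F (Function.update U ℓ h)) ^ 2
          ∂(haarProbability G) ∂(wilsonMeasure r.ρ β : Measure (GaugeConfig 4 (2 * S + 1) G)) else 0) ≤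
    C * ∑ ℓ : Edge 4 (2 * S + 1), ∫ U, ∫ g, (F U - F (Function.update U ℓ g)) ^ 2
      ∂((haarProbability G).tilted (fun g' => -β * wilsonAction r.ρ (Function.update U ℓ g')))
      ∂(wilsonMeasure r.ρ β : Measure (GaugeConfig 4 (2 * S + 1) G))

/-- Statement of the planner's stub (2) `stub_gaugeOrbitGap` (now a theorem from (2a)–(2c), `gaugeOrbitGap_of`). -/
def GaugeOrbitGap : Prop :=
  ∀ (G : Type) [Group G] [TopologicalSpace G] [IsTopologicalGroup G] [CompactSpace G]
    [MeasurableSpace G] [BorelSpace G] (r : LatticeRep G) (β : ℝ), ∃ C : ℝ, ∀ (S : ℕ)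
    (F : GaugeConfig 4 (2 * S + 1) G → ℝ), Measurable F → (∃ M : ℝ, ∀ U, |F U| ≤ M) →
    ∫ U, variance (fun g : Site 4 (2 * S + 1) → G => F (gaugeTransform g U))
        (Measure.pi fun _ : Site 4 (2 * S + 1) => haarProbability G)
      ∂(wilsonMeasure r.ρ β : Measure (GaugeConfig 4 (2 * S + 1) G)) ≤
    C * ∑ ℓ : Edge 4 (2 * S + 1), ∫ U, ∫ g, (F U - F (Function.update U ℓ g)) ^ 2
      ∂((haarProbability G).tilted (fun g' => -β * wilsonAction r.ρ (Function.update U ℓ g')))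
      ∂(wilsonMeasure r.ρ β : Measure (GaugeConfig 4 (2 * S + 1) G))

/-- Statement of stub (3) `stub_dirichlet_orbitAverage_le`. -/
def DirichletOrbitAverageLe : Prop :=
  ∀ (G : Type) [Group G] [TopologicalSpace G] [IsTopologicalGroup G] [CompactSpace G]
    [MeasurableSpace G] [BorelSpace G] (r : LatticeRep G) (β : ℝ) (S : ℕ)
    (F : GaugeConfig 4 (2 * S + 1) G → ℝ), Measurable F → (∃ M : ℝ, ∀ U, |F U| ≤ M) →
    (∑ ℓ : Edge 4 (2 * S + 1), ∫ U, ∫ g,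
        ((∫ k, F (gaugeTransform k U) ∂(Measure.pi fun _ : Site 4 (2 * S + 1) => haarProbability G)) -
          (∫ k, F (gaugeTransform k (Function.update U ℓ g))
            ∂(Measure.pi fun _ : Site 4 (2 * S + 1) => haarProbability G))) ^ 2
      ∂((haarProbability G).tilted (fun g' => -β * wilsonAction r.ρ (Function.update U ℓ g')))
      ∂(wilsonMeasure r.ρ β : Measure (GaugeConfig 4 (2 * S + 1) G))) ≤
    ∑ ℓ : Edge 4 (2 * S + 1), ∫ U, ∫ g, (F U - F (Function.update U ℓ g)) ^ 2
      ∂((haarProbability G).tilted (fun g' => -β * wilsonAction r.ρ (Function.update U ℓ g')))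
      ∂(wilsonMeasure r.ρ β : Measure (GaugeConfig 4 (2 * S + 1) G))

/-- Statement of stub (4a) `stub_fsPoincareInv_simplyConnected`. -/
def FSPoincareInvSimplyConnected : Prop :=
  ∀ (G : Type) [Group G] [TopologicalSpace G] [IsTopologicalGroup G] [CompactSpace G]
    [MeasurableSpace G] [BorelSpace G], IsCompactSimpleLieGroup G → SimplyConnectedSpace G →
    ∀ (r : LatticeRep G) (β : ℝ), 0 ≤ β → FS r β → UPInv r β

/-- Statement of stub (4b) `stub_fsPoincareInv_nonSimplyConnected`. -/
def FSPoincareInvNonSimplyConnected : Prop :=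
  ∀ (G : Type) [Group G] [TopologicalSpace G] [IsTopologicalGroup G] [CompactSpace G]
    [MeasurableSpace G] [BorelSpace G], IsCompactSimpleLieGroup G → ¬ SimplyConnectedSpace G →
    ∀ (r : LatticeRep G) (β : ℝ), 0 ≤ β → FS r β → UPInv r β

/-! ### §2 The registered stubs (`sorry` only here; (1) is landed and carries its tree proof) -/

/-- `stub_orbitSliceSplit` — **orbit–slice splitting of the variance** (stub (1); LANDED p72371 as
`Summit.QuantumFields.YangMills.Theorems.SusceptibilityToPoincare.stub_orbitSliceSplit`, imported). -/
theorem stub_orbitSliceSplit :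
    ∀ (G : Type) [Group G] [TopologicalSpace G] [IsTopologicalGroup G] [CompactSpace G]
      [MeasurableSpace G] [BorelSpace G] (r : LatticeRep G) (β : ℝ) (S : ℕ)
      (F : GaugeConfig 4 (2 * S + 1) G → ℝ), Measurable F → ∀ M : ℝ, (∀ U, |F U| ≤ M) →
      Measurable (fun U : GaugeConfig 4 (2 * S + 1) G =>
          ∫ g, F (gaugeTransform g U) ∂(Measure.pi fun _ : Site 4 (2 * S + 1) => haarProbability G)) ∧
      (∀ U : GaugeConfig 4 (2 * S + 1) G,
          |∫ g, F (gaugeTransform g U) ∂(Measure.pi fun _ : Site 4 (2 * S + 1) => haarProbability G)| ≤ M) ∧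
      IsGaugeInvariant (fun U : GaugeConfig 4 (2 * S + 1) G =>
          ∫ g, F (gaugeTransform g U) ∂(Measure.pi fun _ : Site 4 (2 * S + 1) => haarProbability G)) ∧
      variance F (wilsonMeasure r.ρ β : Measure (GaugeConfig 4 (2 * S + 1) G)) ≤
        variance (fun U : GaugeConfig 4 (2 * S + 1) G =>
            ∫ g, F (gaugeTransform g U) ∂(Measure.pi fun _ : Site 4 (2 * S + 1) => haarProbability G))
          (wilsonMeasure r.ρ β : Measure (GaugeConfig 4 (2 * S + 1) G)) +
        ∫ U, variance (fun g : Site 4 (2 * S + 1) → G => F (gaugeTransform g U))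
            (Measure.pi fun _ : Site 4 (2 * S + 1) => haarProbability G)
          ∂(wilsonMeasure r.ρ β : Measure (GaugeConfig 4 (2 * S + 1) G)) :=
  Summit.QuantumFields.YangMills.Theorems.SusceptibilityToPoincare.stub_orbitSliceSplit

/-- `stub_orbitEfronStein` — **Efron–Stein on the gauge group** (stub (2a), provable now, size M). For every compact `G`,
lattice representation `r`, real `β`, side `2S+1` and bounded measurable `F`:
`∫ Var_π(g ↦ F(U^g)) dμ(U) ≤ ½ Σ_x ∫∫ (F U − F(U^{k at x}))² dHaar(k) dμ(U)`, where `U^{k at x} = gaugeTransform (update 1 x k) U`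
rotates the single site `x` by `k`. Proof: the tree's Efron–Stein inequality (`Literature.Probability.Moments.EfronSteinInequality_holds`,
independent-copy form `Var_π f ≤ ½ Σ_x ∫∫ (f g − f (update g x k))² dHaar(k) dπ(g)`) for `f g = F(U^g)` (measurable and bounded:
joint continuity `continuous_gaugeAction_univ`, second countability of `G` through `r`); then `U^{update g x k} = (U^g)^{update 1 x (k g_x⁻¹)}`
(`gaugeTransform_mul`), the substitution `k ↦ k g_x` (right invariance of `haarProbability`), Fubini, and invariance of `μ` under
`U ↦ U^g` (`integral_comp_gaugeTransform_wilsonMeasure`) turn the `x`-summand into `∫∫ (F V − F(V^{k at x}))² dk dμ(V)` for every `g`. -/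
theorem stub_orbitEfronStein :
    ∀ (G : Type) [Group G] [TopologicalSpace G] [IsTopologicalGroup G] [CompactSpace G]
      [MeasurableSpace G] [BorelSpace G] (r : LatticeRep G) (β : ℝ) (S : ℕ)
      (F : GaugeConfig 4 (2 * S + 1) G → ℝ), Measurable F → (∃ M : ℝ, ∀ U, |F U| ≤ M) →
      ∫ U, variance (fun g : Site 4 (2 * S + 1) → G => F (gaugeTransform g U))
          (Measure.pi fun _ : Site 4 (2 * S + 1) => haarProbability G)
        ∂(wilsonMeasure r.ρ β : Measure (GaugeConfig 4 (2 * S + 1) G)) ≤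
      (1 / 2 : ℝ) * ∑ x : Site 4 (2 * S + 1), ∫ U, ∫ k,
          (F U - F (gaugeTransform (Function.update (1 : Site 4 (2 * S + 1) → G) x k) U)) ^ 2
        ∂(haarProbability G) ∂(wilsonMeasure r.ρ β : Measure (GaugeConfig 4 (2 * S + 1) G)) := by
  sorry

/-- `stub_siteRotation_le` — **a site rotation costs at most the Haar resampling of its incident links** (stub (2b), provable
now, size M+). There is `C = C(G, r, β)` (e.g. `64 e^{c N |β|}`) such that for every side `2S+1`, bounded measurable `F` and site `x`:
`∫∫ (F U − F(U^{k at x}))² dHaar(k) dμ(U) ≤ C Σ_{ℓ : ℓ.1 = x ∨ ℓ.1.shift ℓ.2 = x} ∫∫ (F U − F(U[ℓ ↦ h]))² dHaar(h) dμ(U)`.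
Proof: `U^{k at x}` changes only the `m ≤ 8` links `ℓ` incident to `x`, each by `U_ℓ ↦ a U_ℓ b⁻¹` with `a, b ∈ {1, k}` (conjugation
for the self-loops of side 1); telescope along an enumeration of these links, `(F U − F(U^{k at x}))² ≤ m Σ_j (F U^{(j−1)} − F U^{(j)})²`;
for the `j`-th term insert an independent `h ∼ Haar`: `(F V − F(V[ℓ↦a V_ℓ b⁻¹]))² ≤ 2(F V − F(V[ℓ↦h]))² + 2(F W − F(W[ℓ↦h]))²`, `W = V[ℓ ↦ a V_ℓ b⁻¹]`,
and use the DENSITY BOUND: for fixed `k`, every map `T` of `G^E` that multiplies some coordinates on the left/right by fixed group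
elements preserves `Haar^{⊗E}` (`measurePreserving_mul_mul_inv_haarProbability`, `measurePreserving_pi`) and changes the Wilson action by
at most `2N·#{plaquettes touching the modified links}`, so by `wilsonMeasure_eq_tilted_pi` `∫ ψ∘T dμ ≤ e^{2|β|·K} ∫ ψ dμ` for `ψ ≥ 0`
(here `K ≤ 8·6·2N`); all integrands are bounded and jointly measurable (second countability of `G` through `r`). No `S`-dependence. -/
theorem stub_siteRotation_le :
    ∀ (G : Type) [Group G] [TopologicalSpace G] [IsTopologicalGroup G] [CompactSpace G]
      [MeasurableSpace G] [BorelSpace G] (r : LatticeRep G) (β : ℝ), ∃ C : ℝ, ∀ (S : ℕ)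
      (F : GaugeConfig 4 (2 * S + 1) G → ℝ), Measurable F → (∃ M : ℝ, ∀ U, |F U| ≤ M) →
      ∀ x : Site 4 (2 * S + 1),
      ∫ U, ∫ k, (F U - F (gaugeTransform (Function.update (1 : Site 4 (2 * S + 1) → G) x k) U)) ^ 2
        ∂(haarProbability G) ∂(wilsonMeasure r.ρ β : Measure (GaugeConfig 4 (2 * S + 1) G)) ≤
      C * ∑ ℓ : Edge 4 (2 * S + 1), if (ℓ.1 = x ∨ ℓ.1.shift ℓ.2 = x) then
          ∫ U, ∫ h, (F U - F (Function.update U ℓ h)) ^ 2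
            ∂(haarProbability G) ∂(wilsonMeasure r.ρ β : Measure (GaugeConfig 4 (2 * S + 1) G)) else 0 := by
  sorry

/-- `stub_haarResample_le_heatBath` — **Haar resampling of a link is dominated by heat-bath resampling, and double counting**
(stub (2c), provable now, size M). There is `C = C(G, r, β)` (e.g. `2 e^{12 N |β|}`) such that for every side `2S+1` and bounded
measurable `F`: `Σ_x Σ_{ℓ incident to x} ∫∫ (F U − F(U[ℓ↦h]))² dHaar(h) dμ(U) ≤ C Σ_ℓ ∫∫ (F U − F(U[ℓ↦g]))² dν_ℓ^U(g) dμ(U)`,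
`ν_ℓ^U = Haar.tilted(−β S_W(U[ℓ ↦ ·]))`. Proof: each link `ℓ` is incident (`ℓ.1 = x ∨ ℓ.1.shift ℓ.2 = x`) to at most two sites, so the
left side is `≤ 2 Σ_ℓ ∫∫ (…)² dHaar dμ` (nonnegative summands); and pointwise in `U`, the tilt `h ↦ −β S_W(U[ℓ↦h])` oscillates by at most
`12 N |β|` (only the ≤ 6 plaquettes containing `ℓ` depend on `h`, each term `N − Re tr ρ ∈ [0, 2N]` by unitarity), so the density of
`ν_ℓ^U` w.r.t. Haar is `≥ e^{−12N|β|}` (Mathlib `Measure.tilted`, `integral_tilted`) and `∫ ψ dHaar ≤ e^{12N|β|} ∫ ψ dν_ℓ^U` for `ψ ≥ 0`;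
integrate `dμ` (outer integrands bounded and measurable in `U`: joint measurability of `(U,h) ↦ (F U − F(U[ℓ↦h]))² e^{−βS_W(U[ℓ↦h])}`). -/
theorem stub_haarResample_le_heatBath :
    ∀ (G : Type) [Group G] [TopologicalSpace G] [IsTopologicalGroup G] [CompactSpace G]
      [MeasurableSpace G] [BorelSpace G] (r : LatticeRep G) (β : ℝ), ∃ C : ℝ, ∀ (S : ℕ)
      (F : GaugeConfig 4 (2 * S + 1) G → ℝ), Measurable F → (∃ M : ℝ, ∀ U, |F U| ≤ M) →
      ∑ x : Site 4 (2 * S + 1), ∑ ℓ : Edge 4 (2 * S + 1), (if (ℓ.1 = x ∨ ℓ.1.shift ℓ.2 = x) then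
          ∫ U, ∫ h, (F U - F (Function.update U ℓ h)) ^ 2
            ∂(haarProbability G) ∂(wilsonMeasure r.ρ β : Measure (GaugeConfig 4 (2 * S + 1) G)) else 0) ≤
      C * ∑ ℓ : Edge 4 (2 * S + 1), ∫ U, ∫ g, (F U - F (Function.update U ℓ g)) ^ 2
        ∂((haarProbability G).tilted (fun g' => -β * wilsonAction r.ρ (Function.update U ℓ g')))
        ∂(wilsonMeasure r.ρ β : Measure (GaugeConfig 4 (2 * S + 1) G)) := by
  sorry

/-- `stub_dirichlet_orbitAverage_le` — **orbit averaging contracts the heat-bath Dirichlet form** (stub (3), provable now,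
size M+). For bounded measurable `F`, `ℰ_hb(F̄) ≤ ℰ_hb(F)` termwise in `ℓ`: by Jensen in `k` (π a probability measure),
`(F̄ U − F̄ (U[ℓ↦g]))² ≤ ∫ (F(U^k) − F((U[ℓ↦g])^k))² dπ(k)`; `(U[ℓ↦g])^k = U^k[ℓ ↦ a g b⁻¹]` with `a = k ℓ.1`, `b = k (ℓ.1.shift ℓ.2)`;
the heat-bath law is gauge-COVARIANT, `∫ ψ dν_ℓ^{U^k} = ∫ ψ(a g b⁻¹) dν_ℓ^U(g)` (`wilsonAction_gaugeTransform` + two-sided invariance of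
Haar `measurePreserving_mul_mul_inv_haarProbability`, through `Measure.tilted`), so for each `k` the `(U,g)`-integral equals
`∫∫ (F V − F(V[ℓ↦g']))² dν_ℓ^V dμ(V)` after `V = U^k` (invariance of `μ`: `integral_comp_gaugeTransform_wilsonMeasure`); integrate `dπ(k)`
(Tonelli; all integrands nonnegative, bounded, jointly measurable by second countability of `G` through `r`). Every compact `G`, real `β`, `S`. -/
theorem stub_dirichlet_orbitAverage_le :
    ∀ (G : Type) [Group G] [TopologicalSpace G] [IsTopologicalGroup G] [CompactSpace G]
      [MeasurableSpace G] [BorelSpace G] (r : LatticeRep G) (β : ℝ) (S : ℕ)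
      (F : GaugeConfig 4 (2 * S + 1) G → ℝ), Measurable F → (∃ M : ℝ, ∀ U, |F U| ≤ M) →
      (∑ ℓ : Edge 4 (2 * S + 1), ∫ U, ∫ g,
          ((∫ k, F (gaugeTransform k U) ∂(Measure.pi fun _ : Site 4 (2 * S + 1) => haarProbability G)) -
            (∫ k, F (gaugeTransform k (Function.update U ℓ g))
              ∂(Measure.pi fun _ : Site 4 (2 * S + 1) => haarProbability G))) ^ 2
        ∂((haarProbability G).tilted (fun g' => -β * wilsonAction r.ρ (Function.update U ℓ g')))
        ∂(wilsonMeasure r.ρ β : Measure (GaugeConfig 4 (2 * S + 1) G))) ≤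
      ∑ ℓ : Edge 4 (2 * S + 1), ∫ U, ∫ g, (F U - F (Function.update U ℓ g)) ^ 2
        ∂((haarProbability G).tilted (fun g' => -β * wilsonAction r.ρ (Function.update U ℓ g')))
        ∂(wilsonMeasure r.ρ β : Measure (GaugeConfig 4 (2 * S + 1) G)) := by
  sorry

/-- `stub_fsPoincareInv_simplyConnected` — **the infrared content on the invariant σ-algebra, simply-connected case**
(stub (4a); OPEN, XL; held by the lead): for compact simple `G` with `π₁(G) = 0`, faithful unitary `r`, `β ≥ 0`:
FS(r, β) ⇒ UP_inv(r, β). Why plausibly true: for simply-connected `G` no topological sector of the symmetric torus is protected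
under link updates, so a counterexample needs a gapless regime WITHOUT local order parameter and with summable singlet
correlations — none known for simple `G` in d = 4. Why it might fail: FS = ℓ¹-summability does not imply finite correlation
length (a massless phase with `Δ(tr F²) > 2`, or an `α < 0` continuous bulk transition, gives FS true / UP_inv false). No theorem
of the kind exists for any lattice gauge theory outside the Dobrushin/Bakry–Émery window (ShenZhuZhu2022, arXiv:2401.13299).
Sources: arXiv:2203.04163, BauerschmidtDagallier2023, BauerschmidtBodineauDagallierPolchinski2024, MartinelliOlivieri1994, DingSongSun2022. -/
theorem stub_fsPoincareInv_simplyConnected :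
    ∀ (G : Type) [Group G] [TopologicalSpace G] [IsTopologicalGroup G] [CompactSpace G]
      [MeasurableSpace G] [BorelSpace G], IsCompactSimpleLieGroup G → SimplyConnectedSpace G →
      ∀ (r : LatticeRep G) (β : ℝ), 0 ≤ β →
      (∀ A B : YMSpecies G, ∃ χ : ℝ, ∀ S : ℕ, ∑ x ∈ Literature.Probability.LatticeModels.box 4 S,
        |covariance (fun U => A.F (Literature.MathematicalPhysics.QuantumLattice.torusLift (2 * S + 1) U))
          (fun U => B.F (Literature.MathematicalPhysics.QuantumLattice.configShift (-x)
          (Literature.MathematicalPhysics.QuantumLattice.torusLift (2 * S + 1) U)))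
          (wilsonMeasure r.ρ β : Measure (GaugeConfig 4 (2 * S + 1) G))| ≤ χ) →
      ∃ C : ℝ, ∀ S : ℕ, ∀ F : GaugeConfig 4 (2 * S + 1) G → ℝ, Measurable F → (∃ M : ℝ, ∀ U, |F U| ≤ M) →
        IsGaugeInvariant F →
        variance F (wilsonMeasure r.ρ β : Measure (GaugeConfig 4 (2 * S + 1) G)) ≤
          C * ∑ ℓ : Edge 4 (2 * S + 1), ∫ U, ∫ g, (F U - F (Function.update U ℓ g)) ^ 2
            ∂((haarProbability G).tilted (fun g' => -β * wilsonAction r.ρ (Function.update U ℓ g')))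
            ∂(wilsonMeasure r.ρ β : Measure (GaugeConfig 4 (2 * S + 1) G)) := by
  sorry

/-- `stub_fsPoincareInv_nonSimplyConnected` — **the invariant-sector implication for `π₁(G) ≠ 0`** (stub (4b); SCOPE
SENTINEL, suspected FALSE at large `β`, not staffed): FS ⇒ UP_inv for compact simple `G` that is NOT simply connected (SO(3),
PSU(N), …). Killed MODULO `H = TwistSectorInputs` by the standing disprover (`Disproof.stub4b_false_of_twistSectorInputs`:
't Hooft magnetic twist sectors are gauge-invariant events of non-degenerate mass with vanishing single-link heat-bath flux);
an unconditional refutation needs FS of SO(3)₄ at weak coupling (open). Registered so that a refutation BY NAME re-scopes the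
crux to `SimplyConnectedSpace G` (planner) while (1)–(3), (4a) stay verbatim. -/
theorem stub_fsPoincareInv_nonSimplyConnected :
    ∀ (G : Type) [Group G] [TopologicalSpace G] [IsTopologicalGroup G] [CompactSpace G]
      [MeasurableSpace G] [BorelSpace G], IsCompactSimpleLieGroup G → ¬ SimplyConnectedSpace G →
      ∀ (r : LatticeRep G) (β : ℝ), 0 ≤ β →
      (∀ A B : YMSpecies G, ∃ χ : ℝ, ∀ S : ℕ, ∑ x ∈ Literature.Probability.LatticeModels.box 4 S,
        |covariance (fun U => A.F (Literature.MathematicalPhysics.QuantumLattice.torusLift (2 * S + 1) U))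
          (fun U => B.F (Literature.MathematicalPhysics.QuantumLattice.configShift (-x)
          (Literature.MathematicalPhysics.QuantumLattice.torusLift (2 * S + 1) U)))
          (wilsonMeasure r.ρ β : Measure (GaugeConfig 4 (2 * S + 1) G))| ≤ χ) →
      ∃ C : ℝ, ∀ S : ℕ, ∀ F : GaugeConfig 4 (2 * S + 1) G → ℝ, Measurable F → (∃ M : ℝ, ∀ U, |F U| ≤ M) →
        IsGaugeInvariant F →
        variance F (wilsonMeasure r.ρ β : Measure (GaugeConfig 4 (2 * S + 1) G)) ≤
          C * ∑ ℓ : Edge 4 (2 * S + 1), ∫ U, ∫ g, (F U - F (Function.update U ℓ g)) ^ 2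
            ∂((haarProbability G).tilted (fun g' => -β * wilsonAction r.ρ (Function.update U ℓ g')))
            ∂(wilsonMeasure r.ρ β : Measure (GaugeConfig 4 (2 * S + 1) G)) := by
  sorry

/-! ### §3 The kernel-checked composition (sorry-free) -/

/-- Real arithmetic of (2a)–(2c): `V ≤ ½ Σ A`, `A x ≤ C_b B x`, `0 ≤ B x`, `Σ B ≤ C_c E` give `V ≤ (½ max C_b 0 · C_c) E`. -/
theorem orbit_arith {ι : Type*} [Fintype ι] {V E Cb Cc : ℝ} {A B : ι → ℝ}
    (hV : V ≤ (1 / 2 : ℝ) * ∑ x, A x) (hA : ∀ x, A x ≤ Cb * B x) (hB0 : ∀ x, 0 ≤ B x)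
    (hB : ∑ x, B x ≤ Cc * E) : V ≤ ((1 / 2 : ℝ) * (max Cb 0 * Cc)) * E := by
  have h1 : ∀ x, A x ≤ max Cb 0 * B x := fun x =>
    (hA x).trans (mul_le_mul_of_nonneg_right (le_max_left _ _) (hB0 x))
  have h2 : ∑ x, A x ≤ max Cb 0 * ∑ x, B x := by
    rw [Finset.mul_sum]
    exact Finset.sum_le_sum fun x _ => h1 x
  have h3 : max Cb 0 * ∑ x, B x ≤ max Cb 0 * (Cc * E) :=
    mul_le_mul_of_nonneg_left hB (le_max_right _ _)
  nlinarith [hV, h2, h3]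

/-- **(2) from (2a)–(2c)**: the gauge-variant sector has a volume-uniform heat-bath gap (the planner's `stub_gaugeOrbitGap`,
now proved from the three registered sub-stubs). -/
theorem gaugeOrbitGap_of (h2a : OrbitEfronStein) (h2b : SiteRotationLe) (h2c : HaarResampleLeHeatBath) :
    GaugeOrbitGap := by
  intro G _ _ _ _ _ _ r β
  obtain ⟨Cb, hCb⟩ := h2b G r β
  obtain ⟨Cc, hCc⟩ := h2c G r β
  refine ⟨(1 / 2 : ℝ) * (max Cb 0 * Cc), fun S F hF hM => ?_⟩
  refine orbit_arith (h2a G r β S F hF hM) (fun x => hCb S F hF hM x) (fun x => ?_) (hCc S F hF hM)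
  exact Finset.sum_nonneg fun ℓ _ => by
    split_ifs
    · exact integral_nonneg fun _ => integral_nonneg fun _ => sq_nonneg _
    · exact le_rfl

/-- Real arithmetic of the splitting: `V ≤ V' + O`, `O ≤ C₂ E`, `V' ≤ C₁ E'`, `E' ≤ E`, `0 ≤ E'` give
`V ≤ (max C₁ 0 + C₂) E`. -/
theorem split_arith {V V' O E E' C₁ C₂ : ℝ} (h₁ : V ≤ V' + O) (h₂ : O ≤ C₂ * E) (h₃ : V' ≤ C₁ * E')
    (h₄ : E' ≤ E) (h₅ : 0 ≤ E') : V ≤ (max C₁ 0 + C₂) * E := by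
  have h₆ : C₁ * E' ≤ max C₁ 0 * E :=
    (mul_le_mul_of_nonneg_right (le_max_left C₁ 0) h₅).trans
      (mul_le_mul_of_nonneg_left h₄ (le_max_right C₁ 0))
  nlinarith [h₁, h₂, h₃, h₆]

/-- Nonnegativity of the heat-bath Dirichlet form of ANY function (sum of integrals of integrals of squares). -/
theorem hb_nonneg {G : Type} [Group G] [TopologicalSpace G] [IsTopologicalGroup G] [CompactSpace G]
    [MeasurableSpace G] [BorelSpace G] (r : LatticeRep G) (β : ℝ) (S : ℕ)
    (F : GaugeConfig 4 (2 * S + 1) G → ℝ) :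
    0 ≤ ∑ ℓ : Edge 4 (2 * S + 1), ∫ U, ∫ g, (F U - F (Function.update U ℓ g)) ^ 2
        ∂((haarProbability G).tilted (fun g' => -β * wilsonAction r.ρ (Function.update U ℓ g')))
        ∂(wilsonMeasure r.ρ β : Measure (GaugeConfig 4 (2 * S + 1) G)) :=
  Finset.sum_nonneg fun _ _ => integral_nonneg fun _ => integral_nonneg fun _ => sq_nonneg _

/-- **The TRANSFER of the idea card, proved from stubs (1), (2a)–(2c), (3)**: for EVERY compact `G`, lattice representation
`r` and real `β`, UP_inv(r, β) ⇒ UP(r, β), with constant `max C_inv 0 + C_orbit(β)`. (With `upInv_of_up`: UP ⇔ UP_inv.) -/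
theorem transfer_of (h₁ : OrbitSliceSplit) (h2a : OrbitEfronStein) (h2b : SiteRotationLe)
    (h2c : HaarResampleLeHeatBath) (h₃ : DirichletOrbitAverageLe) :
    ∀ (G : Type) [Group G] [TopologicalSpace G] [IsTopologicalGroup G] [CompactSpace G]
      [MeasurableSpace G] [BorelSpace G] (r : LatticeRep G) (β : ℝ), UPInv r β → UP r β := by
  have h₂ : GaugeOrbitGap := gaugeOrbitGap_of h2a h2b h2c
  intro G _ _ _ _ _ _ r β hinv
  obtain ⟨C₁, hC₁⟩ := hinv
  obtain ⟨C₂, hC₂⟩ := h₂ G r β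
  refine ⟨max C₁ 0 + C₂, fun S F hF hbd => ?_⟩
  obtain ⟨M, hM⟩ := hbd
  obtain ⟨hmeas, hbdd, hginv, hsplit⟩ := h₁ G r β S F hF M hM
  have horb := hC₂ S F hF ⟨M, hM⟩
  have hbar := hC₁ S (fun U : GaugeConfig 4 (2 * S + 1) G =>
      ∫ g, F (gaugeTransform g U) ∂(Measure.pi fun _ : Site 4 (2 * S + 1) => haarProbability G))
    hmeas ⟨M, hbdd⟩ hginv
  have hdir := h₃ G r β S F hF ⟨M, hM⟩
  have hnn := hb_nonneg r β S (fun U : GaugeConfig 4 (2 * S + 1) G =>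
      ∫ g, F (gaugeTransform g U) ∂(Measure.pi fun _ : Site 4 (2 * S + 1) => haarProbability G))
  exact split_arith hsplit horb hbar hdir hnn

/-- **The crux is EQUIVALENT to its invariant form `C⁺`** (given stubs (1)–(3)). -/
theorem crux_iff_inv_of (h₁ : OrbitSliceSplit) (h2a : OrbitEfronStein) (h2b : SiteRotationLe)
    (h2c : HaarResampleLeHeatBath) (h₃ : DirichletOrbitAverageLe) :
    Summit.QuantumFields.YangMills.Theses.FradkinShenkerFlow.SusceptibilityToPoincare ↔
      ∀ (G : Type) [Group G] [TopologicalSpace G] [IsTopologicalGroup G] [CompactSpace G]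
        [MeasurableSpace G] [BorelSpace G], IsCompactSimpleLieGroup G →
        ∀ (r : LatticeRep G) (β : ℝ), 0 ≤ β → FS r β → UPInv r β := by
  refine ⟨fun h G _ _ _ _ _ _ hG r β hβ hFS => upInv_of_up r β (h G hG r β hβ hFS),
    fun h G _ _ _ _ _ _ hG r β hβ hFS => ?_⟩
  exact transfer_of h₁ h2a h2b h2c h₃ G r β (h G hG r β hβ hFS)

/-- **Composition** (sorry-free, standard axioms): the seven stub STATEMENTS imply the crux in its unfolded form —
the invariant-sector constant by cases on `π₁(G) = 0` (stubs 4a/4b), then the transfer (stubs 1, 2a–2c, 3). -/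
theorem composition (h₁ : OrbitSliceSplit) (h2a : OrbitEfronStein) (h2b : SiteRotationLe)
    (h2c : HaarResampleLeHeatBath) (h₃ : DirichletOrbitAverageLe) (h₄ : FSPoincareInvSimplyConnected)
    (h₅ : FSPoincareInvNonSimplyConnected) :
    ∀ (G : Type) [Group G] [TopologicalSpace G] [IsTopologicalGroup G] [CompactSpace G]
      [MeasurableSpace G] [BorelSpace G], IsCompactSimpleLieGroup G →
      ∀ (r : LatticeRep G) (β : ℝ), 0 ≤ β → FS r β → UP r β := by
  intro G _ _ _ _ _ _ hG r β hβ hFS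
  have hinv : UPInv r β := by
    by_cases hsc : SimplyConnectedSpace G
    · exact h₄ G hG hsc r β hβ hFS
    · exact h₅ G hG hsc r β hβ hFS
  exact transfer_of h₁ h2a h2b h2c h₃ G r β hinv

/-- **The skeleton theorem**: the crux BY NAME from the registered stubs (its only non-whitelisted axiom is the `sorryAx`
of the six open stubs; `composition` is the sorry-free logic; stub (1) is the landed tree theorem). -/
theorem SusceptibilityToPoincare_of :
    Summit.QuantumFields.YangMills.Theses.FradkinShenkerFlow.SusceptibilityToPoincare :=
  crux_iff.2 (composition stub_orbitSliceSplit stub_orbitEfronStein stub_siteRotation_le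
    stub_haarResample_le_heatBath stub_dirichlet_orbitAverage_le
    stub_fsPoincareInv_simplyConnected stub_fsPoincareInv_nonSimplyConnected)

end

end Summit.QuantumFields.YangMills.Cruxes.SusceptibilityToPoincare.OrbitSliceReduction
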